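import Summits.BirchSwinnertonDyer.BirchSwinnertonDyer.Theorems.ResidualThetaTransportAtTwoThetaLayerLambdaCongruenceAtTwoCuspSpanFunctionalNeg
import HarnessLib

/-!
# Route `ResidualThetaTransportAtTwo`, cruxes Kan⁺ (stmt-BirchSwinnertonDyer-20688) / node 27436 / 21437: the COSET-PAIR CRITERION —
# the node at an odd prime `p` as soon as every pair of cosets of `⟨4, −1⟩ ≤ 𝔽ₚˣ` is realised by some `(u, u − 1)`

Cell `bsd-wall`, width seat `bsd-wall-rtt-p3-w5` g2 (2026-08-28). THEOREMS ONLY; `--supports stmt-BirchSwinnertonDyer-20688`; BSD is not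
proved by this.

With the sign companion (`…CuspSpanSignCompanion`) the `B₁`-character `F` of an admissible `χ : Γ₀(p) → 𝔽₂` is constant on the cosets
of `H := ⟨4, −1⟩ ≤ 𝔽ₚˣ`, and Manin's three-term rule (5) `F u + F ((u−1)/u) + F (u−1) = 0` is a relation between the THREE COSETS
`[u]`, `[(u−1)/u] = [u−1] − [u]`, `[u−1]` of the cyclic group `Q := 𝔽ₚˣ/H`: it says that the coboundary
`D(x, y) := F(x) + F(y) + F(xy)` vanishes at `(x, y) = ([u], [(u−1)/u])`. Hence:

* `mul_of_cosetPairs` (**COSET-PAIR CRITERION**, matrix-free): if for all units `x, y` some `u ∉ {0, 1}` has `u ∈ x H` and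
  `u − 1 ∈ x y H` (so `(u−1)/u ∈ y H`), then every `F` with (2) `F(4r) = F(r)`, (5) and (7) `F(−r) = F(r)` is multiplicative on `𝔽ₚˣ`.
* `cuspSpanEvenAtTwo_of_cosetPairs`: under that hypothesis the node `CuspSpanEvenAtTwo p` holds (via Theorem C⁻(p),
  `cuspSpanEvenAtTwo_of_functional_criterion_neg`).

The hypothesis is a statement about the CYCLOTOMIC NUMBERS of order `n := [𝔽ₚˣ : H]`: all `n²` of them are positive. It is decidable
per level, and it HOLDS whenever `p` is large against `n` (Weil/Jacobi-sum bound: `p − 2 − 3(n−1) > (n−1)(n−2)√p` suffices; e.g. at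
186 of the 210 odd primes `< 1300`, seat numerics `analysis/paircond.py`); it FAILS exactly at the small-`⟨4⟩` primes
`17, 41, 109, 113, 127, 157, 241, 257, 277, 331, 337, …`, where the lead's propagation certificates (`…CuspSpanCertP*`) are needed.
The Jacobi-sum theorem is the object of the companion file `…CuspSpanJacobi` (in preparation).

References: Ju. I. Manin, Izv. 36 (1972) §1.5–1.9 [Manin1972]; K. Ireland, M. Rosen, *A classical introduction to modern number
theory*, GTM 84, Ch. 8 §§3–5 (Jacobi sums and `a xⁿ + b yⁿ = 1`); [Pollack2003] Conj. 6.3.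
-/

set_option autoImplicit false
set_option linter.dupNamespace false

open scoped MatrixGroups

open CongruenceSubgroup

namespace Summit.BirchSwinnertonDyer.BirchSwinnertonDyer.Theorems.SignedMuAtTwo

variable {p : ℕ} [Fact p.Prime]

/-- **Coset-pair criterion (matrix-free).** If every pair of cosets of `⟨4, −1⟩ ≤ 𝔽ₚˣ` is realised — for all units `x, y` some
`u ∉ {0, 1}` lies in `x⟨4, −1⟩` with `u − 1 ∈ x y ⟨4, −1⟩` — then every `F : 𝔽ₚ → 𝔽₂` with `F(4r) = F(r)`, `F(−r) = F(r)` and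
Manin's three-term rule `F u + F ((u−1)/u) + F (u−1) = 0` is multiplicative on the units. [cite: Manin1972, §1.5] -/
theorem mul_of_cosetPairs (hp2 : p ≠ 2)
    (hpairs : ∀ x y : ZMod p, x ≠ 0 → y ≠ 0 → ∃ u : ZMod p, u ≠ 0 ∧ u - 1 ≠ 0 ∧
      (∃ k : ℕ, u = 4 ^ k * x ∨ u = -(4 ^ k * x)) ∧ (∃ l : ℕ, u - 1 = 4 ^ l * (x * y) ∨ u - 1 = -(4 ^ l * (x * y))))
    (F : ZMod p → ZMod 2)
    (h4 : ∀ r : ZMod p, r ≠ 0 → F (4 * r) = F r)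
    (h5 : ∀ u : ZMod p, u ≠ 0 → u - 1 ≠ 0 → F u + F ((u - 1) * u⁻¹) + F (u - 1) = 0)
    (h7 : ∀ r : ZMod p, r ≠ 0 → F (-r) = F r) :
    ∀ x y : ZMod p, x ≠ 0 → y ≠ 0 → F (x * y) = F x + F y := by
  have h40 : (4 : ZMod p) ≠ 0 := by
    -- (also `Literature…four_ne_zero_zmod`; inlined to keep the import light)
    have hp : p.Prime := Fact.out
    intro h0
    have h0' : ((4 : ℕ) : ZMod p) = 0 := by exact_mod_cast h0
    have h4 : p ∣ 2 ^ 2 := by norm_num; exact (ZMod.natCast_eq_zero_iff 4 p).mp h0'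
    exact hp2 ((Nat.prime_dvd_prime_iff_eq hp Nat.prime_two).mp (hp.dvd_of_dvd_pow h4))
  have h4k : ∀ (k : ℕ) (r : ZMod p), r ≠ 0 → F (4 ^ k * r) = F r := by
    intro k
    induction k with
    | zero => intro r _; rw [pow_zero, one_mul]
    | succ k ih =>
      intro r hr
      rw [pow_succ, mul_comm (4 ^ k) 4, mul_assoc, h4 _ (mul_ne_zero (pow_ne_zero _ h40) hr), ih r hr]
  have hpm : ∀ (k : ℕ) (r s : ZMod p), r ≠ 0 → (s = 4 ^ k * r ∨ s = -(4 ^ k * r)) → F s = F r := by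
    rintro k r s hr (rfl | rfl)
    · exact h4k k r hr
    · rw [h7 _ (mul_ne_zero (pow_ne_zero _ h40) hr), h4k k r hr]
  intro x y hx hy
  obtain ⟨u, hu, hu1, ⟨k, hk⟩, ⟨l, hl⟩⟩ := hpairs x y hx hy
  have e1 : F u = F x := hpm k x u hx hk
  have e2 : F (u - 1) = F (x * y) := hpm l (x * y) (u - 1) (mul_ne_zero hx hy) hl
  have e3 : F ((u - 1) * u⁻¹) = F y := by
    have key : 4 ^ k * ((u - 1) * u⁻¹) = 4 ^ l * y ∨ 4 ^ k * ((u - 1) * u⁻¹) = -(4 ^ l * y) := by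
      have h4kx : (4 : ZMod p) ^ k * x ≠ 0 := mul_ne_zero (pow_ne_zero _ h40) hx
      rcases hk with hk | hk <;> rcases hl with hl | hl <;> rw [hl, hk]
      · left; field_simp
      · right; field_simp
      · right; field_simp
      · left; field_simp
    rw [← h4k k _ (mul_ne_zero hu1 (inv_ne_zero hu))]
    exact hpm l y _ hy key
  have h := h5 u hu hu1
  rw [e1, e2, e3] at h
  have e : F (x * y) = -(F x + F y) := by linear_combination h
  rw [e, ZMod.neg_eq_self_mod_two]

/-- **The node from the coset-pair condition.** If every pair of cosets of `⟨4, −1⟩ ≤ 𝔽ₚˣ` is realised by some `(u, u − 1)`, then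
`CuspSpanEvenAtTwo p` (Theorem C⁻(p) holds by `mul_of_cosetPairs`; then `cuspSpanEvenAtTwo_of_functional_criterion_neg`).
[cite: Pollack2003, Conj. 6.3] [cite: Manin1972, §1.5] -/
theorem cuspSpanEvenAtTwo_of_cosetPairs (hp2 : p ≠ 2)
    (hpairs : ∀ x y : ZMod p, x ≠ 0 → y ≠ 0 → ∃ u : ZMod p, u ≠ 0 ∧ u - 1 ≠ 0 ∧
      (∃ k : ℕ, u = 4 ^ k * x ∨ u = -(4 ^ k * x)) ∧ (∃ l : ℕ, u - 1 = 4 ^ l * (x * y) ∨ u - 1 = -(4 ^ l * (x * y)))) :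
    CuspSpanEvenAtTwo p :=
  cuspSpanEvenAtTwo_of_functional_criterion_neg hp2
    (fun F _ h4 _ _ hpos _ h7 _ ↦ mul_of_cosetPairs hp2 hpairs F h4 hpos h7)

/-- The trace form (G″)_p from the coset-pair condition (same proof, for consumers of `ψ`). [cite: Pollack2003, Conj. 6.3] -/
theorem cuspSpanTrace_of_cosetPairs (hp2 : p ≠ 2)
    (hpairs : ∀ x y : ZMod p, x ≠ 0 → y ≠ 0 → ∃ u : ZMod p, u ≠ 0 ∧ u - 1 ≠ 0 ∧
      (∃ k : ℕ, u = 4 ^ k * x ∨ u = -(4 ^ k * x)) ∧ (∃ l : ℕ, u - 1 = 4 ^ l * (x * y) ∨ u - 1 = -(4 ^ l * (x * y)))) :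
    ∀ χ : Gamma0 p → ZMod 2,
      (∀ γ δ : Gamma0 p, χ (γ * δ) = χ γ + χ δ) →
      (∀ γ : Gamma0 p, ((γ : SL(2, ℤ)) 0 0 + (γ : SL(2, ℤ)) 1 1).natAbs ≤ 2 → χ γ = 0) →
      (∀ γ : Gamma0 p, (∃ k : ℕ, 1 ≤ k ∧ ((γ : SL(2, ℤ)) 1 1).natAbs = 4 ^ k) → χ γ = 0) →
      ∃ ψ : ZMod p → ZMod 2, (∀ x y : ZMod p, IsUnit x → IsUnit y → ψ (x * y) = ψ x + ψ y) ∧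
        ∀ γ : Gamma0 p, χ γ = ψ ((((γ : SL(2, ℤ)) 1 1 : ℤ) : ZMod p)) :=
  cuspSpanTrace_of_functional_criterion_neg hp2
    (fun F _ h4 _ _ hpos _ h7 _ ↦ mul_of_cosetPairs hp2 hpairs F h4 hpos h7)

end Summit.BirchSwinnertonDyer.BirchSwinnertonDyer.Theorems.SignedMuAtTwo
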